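import Literature.AnabelianGeometry.AbsoluteAnabelian.AbsTopIProp410GeometricResidueProofs
import HarnessLib

/-!
# [AbsTopI] Def 4.2 (i)(c) / Prop 4.10 (iii): a de-cuspidalization datum lives over ONE base field
# — the residue `X.K = Y.K` of node (iii) DISCHARGED (proof-only)

S. Mochizuki, *Topics in Absolute Anabelian Geometry I: Generalities* [AbsTopI] (J. Math. Sci.
Univ. Tokyo 19 (2012)), Def 4.2 (i)(c) p. 48 ("an open immersion `φ : X_j ↪ X_{j+1}` [so
`k_j = k_{j+1}`] — i.e., a "de-cuspidalization""), Def 4.2 (iii)(c) p. 50 ("a surjection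
`Π_j ↠ Π_{j+1}`"), Prop 4.10 (iii) p. 60; manuscript pagination, lit key `paper:url-11ac98ba15fc`,
read on the page.  S. Mochizuki, *Semi-graphs of anabelioids* [SemiAnbd] §6 p. 69
("`1 → Δ^temp_X → Π^temp_{X_K} → G_K → 1`", the profinite completion `Π_{X_K}`).

Context: the cell's sub-DAG `HOME/plan/L4/SUBDAG-AbsTopI-Prop410.md`, node AbsTopI:Prop4.10(iii).
The closers `prop410iiiAt_of_residues'''` / `prop410iiiDeltaAt_of_residues'''`
(`AbsTopIProp410GeometricResidueProofs.lean`) carry the input `hK : X.K = Y.K` (same base field),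
consumed through `exists_aug_eq_of_K_eq` as the same-Galois-image clause
`hrange : ∀ y ∃ g, aug_X g = aug_Y y` of the assembly.  THIS FILE PROVES `hrange`, `X.GK = Y.GK`
and `X.K = Y.K` for EVERY `E : DeCuspidalization X Y` from the typed record alone
(`DeCuspidalization.exists_aug_eq`, `.GK_eq`, `.K_eq`): the profinite augmentations satisfy
`augHat_Y ∘ f̂ = augHat_X` (`DeCuspidalization.augHat_fHat`, `AbsTopIProp410FiniteLevelProofs.lean`:
two continuous homomorphisms `Π̂_X → G_{ℚ_p}` agreeing on the dense `toHat_X(Π^tp_X)`), so the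
surjectivity of `f̂` (field `fHat_surjective`, Def 4.2 (iii)(c)) gives
`aug_Y(Π^tp_Y) ⊆ augHat_X(Π̂_X) ⊆ closure aug_X(Π^tp_X) = G_{K_X}` (open, hence closed, in
`G_{ℚ_p}`); then `G_{K_X} = G_{K_Y}` (`exists_aug_eq_iff_GK_eq`) and `K_X = K_Y` by the Galois
correspondence (Mathlib `InfiniteGalois.fixedField_fixingSubgroup`).  So print's "[so
`k_j = k_{j+1}`]" is a CONSEQUENCE of the typed profinite clause, and the residue list of node
(iii) loses `hK`: closers `prop410iiiAt_of_residues''''` / `prop410iiiDeltaAt_of_residues''''` over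
{(CF_Δ), conj. 1 of `CoFreeCofinalImAlong`, tfg `Δ̂_X`, GroupLevelData ×2, (R2), hmin}.

Inputs are hypotheses stated in the signatures (no new named facts; FACT-LIST untouched).  HONEST
FRAMING: refereed prerequisite papers; nothing here bears on [IUTchIII] Cor 3.12; typed ≠ proved.
-/

noncomputable section

open _root_.Topology Filter

namespace Literature.AnabelianGeometry.AbsoluteAnabelian.AbsTopI.Prop410

open Literature.AnabelianGeometry.SemiGraphs
open Literature.AnabelianGeometry.AbsoluteAnabelian.AbsTopI

variable {p : ℕ} [Fact p.Prime]

/-! ### The image of the profinite augmentation -/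

/-- The image of the profinite augmentation is still `G_K`: `augHat_X(Π̂_X) ⊆ G_{K_X}` (the image
of the dense `Π^tp_X` is `G_{K_X}`, which is open, hence closed, in `G_{ℚ_p}`).  (The same fact is
proved for abc-iut-L5's special-fibre data in `StableCurveTemperedDataOfSpecialFibre.lean`;
restated at this FQN to keep the [AbsTopI] files below the IUT layer.)
[cite: MochizukiSemiAnbd2006, §6 p.69] -/
theorem augHat_mem_GK (X : TemperedCurve p) (z : X.PiHat) : X.augHat z ∈ X.GK := by
  haveI := X.finiteDimensional_K
  have hdense : DenseRange X.toHat := X.isProfiniteCompletion_toHat.denseRange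
  have hclosed : IsClosed (X.GK : Set (GQp p)) :=
    OpenSubgroup.isClosed ⟨X.GK, IntermediateField.fixingSubgroup_isOpen X.K⟩
  have hrange : Set.range X.aug = (X.GK : Set (GQp p)) := by
    rw [TemperedCurve.GK, ← X.range_aug]
    exact (MonoidHom.coe_range X.aug.toMonoidHom).symm
  -- `augHat z ∈ augHat '' closure (range toHat) ⊆ closure (augHat '' range toHat)`
  -- `= closure (range aug) = G_K`
  have h1 : X.augHat z ∈ X.augHat '' closure (Set.range X.toHat) := by
    rw [hdense.closure_range]
    exact ⟨z, Set.mem_univ _, rfl⟩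
  have h2 : X.augHat '' closure (Set.range X.toHat) ⊆ closure (X.augHat '' Set.range X.toHat) :=
    image_closure_subset_closure_image X.augHat.continuous
  have h3 : X.augHat '' Set.range X.toHat = Set.range X.aug := by
    ext σ
    constructor
    · rintro ⟨_, ⟨g, rfl⟩, rfl⟩
      exact ⟨g, (X.augHat_comp g).symm⟩
    · rintro ⟨g, rfl⟩
      exact ⟨X.toHat g, ⟨g, rfl⟩, X.augHat_comp g⟩
  have h4 : X.augHat z ∈ closure (Set.range X.aug) := by
    rw [← h3]
    exact h2 h1
  rw [hrange, hclosed.closure_eq] at h4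
  exact h4

/-! ### Same Galois image, same Galois group, same base field -/

/-- **The same-Galois-image clause `hrange` holds for EVERY de-cuspidalization datum**: for
`y ∈ Π^tp_Y`, `aug_Y y = augHat_Y(toHat_Y y) = augHat_Y(f̂ ẑ) = augHat_X ẑ ∈ G_{K_X}`
`= aug_X(Π^tp_X)` (`f̂` surjective, Def 4.2 (iii)(c) p. 50; `augHat_Y ∘ f̂ = augHat_X`).
[cite: MochizukiAbsTopI2012, Def 4.2 (iii) p.50] -/
theorem DeCuspidalization.exists_aug_eq {X Y : TemperedCurve p} (E : DeCuspidalization X Y)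
    (y : Y.PiTemp) : ∃ g : X.PiTemp, X.aug g = Y.aug y := by
  obtain ⟨z, hz⟩ := E.fHat_surjective (Y.toHat y)
  have hy : Y.aug y = X.augHat z := by
    rw [← Y.augHat_comp, ← hz, E.augHat_fHat]
  have hmem : Y.aug y ∈ X.aug.toMonoidHom.range := by
    rw [X.range_aug, hy]
    exact augHat_mem_GK X z
  obtain ⟨g, hg⟩ := hmem
  exact ⟨g, hg⟩

/-- **`G_{K_X} = G_{K_Y}`** for every de-cuspidalization datum.
[cite: MochizukiAbsTopI2012, Def 4.2 (i) p.48] -/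
theorem DeCuspidalization.GK_eq {X Y : TemperedCurve p} (E : DeCuspidalization X Y) :
    X.GK = Y.GK :=
  (exists_aug_eq_iff_GK_eq E).mp E.exists_aug_eq

/-- **`K_X = K_Y` — "[so `k_j = k_{j+1}`]"** ([AbsTopI] Def 4.2 (i)(c) p. 48) for every
de-cuspidalization datum, by the Galois correspondence for `ℚ̄_p/ℚ_p` (Mathlib
`InfiniteGalois.fixedField_fixingSubgroup`). [cite: MochizukiAbsTopI2012, Def 4.2 (i) p.48] -/
theorem DeCuspidalization.K_eq {X Y : TemperedCurve p} (E : DeCuspidalization X Y) : X.K = Y.K := by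
  haveI : IsGalois ℚ_[p] (AlgebraicClosure ℚ_[p]) := {}
  have h : X.K.fixingSubgroup = Y.K.fixingSubgroup := E.GK_eq
  rw [← InfiniteGalois.fixedField_fixingSubgroup X.K,
    ← InfiniteGalois.fixedField_fixingSubgroup Y.K, h]

/-! ### Node (iii), both clauses, without the same-field input -/

/-- **[AbsTopI] Prop 4.10 (iii), Π-clause, AT THE CONSTRUCTION** over the residues {(CF_Δ), conj. 1
of `CoFreeCofinalImAlong`, tfg `Δ̂_X`, GroupLevelData ×2, (R2), hmin} — the same-field input of
`prop410iiiAt_of_residues'''` being the theorem `DeCuspidalization.K_eq`.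
[cite: MochizukiAbsTopI2012, Prop 4.10 (iii) p.60] -/
theorem prop410iiiAt_of_residues'''' {X Y : TemperedCurve p} (E : DeCuspidalization X Y)
    (hΔ : ∀ N : OpenNormalSubgroup Y.DeltaTemp, ∃ H' : CharOpenSubgroup Y.DeltaTemp,
      (cofreeCore H'.toSubgroup).subgroupOf Y.DeltaTemp ≤ N.toSubgroup)
    (hleft : ∀ H : CharOpenSubgroup X.DeltaTemp, ∃ H' : CharOpenSubgroup Y.DeltaTemp,
      coFreeKernel ((ContinuousMonoidHom.id Y.PiHat).comp Y.toHat) H'.toSubgroup ≤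
        coFreeKernel (E.fHat.comp X.toHat) H.toSubgroup)
    (hfg : IsTopologicallyFinitelyGenerated X.DeltaHat)
    (dX : X.GroupLevelData) (dY : Y.GroupLevelData)
    (hR2 : ∀ H' : CharOpenSubgroup Y.DeltaTemp,
      H'.toSubgroup ≤ (H'.toSubgroup.comap E.f.toMonoidHom).map E.f.toMonoidHom ⊔
        cofreeCore H'.toSubgroup)
    (hmin : ∀ H' : CharOpenSubgroup Y.DeltaTemp, ∃ M, IsMinimalCofreeIn H'.toSubgroup M) :
    Prop410iiiAt E :=
  prop410iiiAt_of_residues''' E hΔ hleft hfg E.K_eq dX dY hR2 hmin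

/-- **[AbsTopI] Prop 4.10 (iii), Δ-clause, AT THE CONSTRUCTION** over the same six residues.
[cite: MochizukiAbsTopI2012, Prop 4.10 (iii) p.60] -/
theorem prop410iiiDeltaAt_of_residues'''' {X Y : TemperedCurve p} (E : DeCuspidalization X Y)
    (hΔ : ∀ N : OpenNormalSubgroup Y.DeltaTemp, ∃ H' : CharOpenSubgroup Y.DeltaTemp,
      (cofreeCore H'.toSubgroup).subgroupOf Y.DeltaTemp ≤ N.toSubgroup)
    (hleft : ∀ H : CharOpenSubgroup X.DeltaTemp, ∃ H' : CharOpenSubgroup Y.DeltaTemp,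
      coFreeKernel ((ContinuousMonoidHom.id Y.PiHat).comp Y.toHat) H'.toSubgroup ≤
        coFreeKernel (E.fHat.comp X.toHat) H.toSubgroup)
    (hfg : IsTopologicallyFinitelyGenerated X.DeltaHat)
    (dX : X.GroupLevelData) (dY : Y.GroupLevelData)
    (hR2 : ∀ H' : CharOpenSubgroup Y.DeltaTemp,
      H'.toSubgroup ≤ (H'.toSubgroup.comap E.f.toMonoidHom).map E.f.toMonoidHom ⊔
        cofreeCore H'.toSubgroup)
    (hmin : ∀ H' : CharOpenSubgroup Y.DeltaTemp, ∃ M, IsMinimalCofreeIn H'.toSubgroup M) :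
    Prop410iiiDeltaAt E :=
  prop410iiiDeltaAt_of_residues''' E hΔ hleft hfg E.K_eq dX dY hR2 hmin

end Literature.AnabelianGeometry.AbsoluteAnabelian.AbsTopI.Prop410

end
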